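import Literature.IUT.HodgeTheaters.StableCurveTemperedDataOfSpecialFibreSec2HTFOfFreePro
import Literature.IUT.HodgeTheaters.StableCurveTemperedDataOfSpecialFibreCor25XRoute
import Literature.AnabelianGeometry.SemiGraphs.ProSigmaCompletionProfiniteExtend
import Literature.AnabelianGeometry.SemiGraphs.ProSigmaCompletionModels
import HarnessLib

/-!
# [IUTchI] Prop. 2.4 / Cor. 2.5 at the genuine 𝔛-datum: the two kernel shapes of the origin fact
# "`Δ̂_X` is the profinite completion of a free group" are EQUIVALENT; joint non-vacuity of the
# `IsProSigmaCompletion`-form of the §2 one-call's origin binder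

S. Mochizuki, *Inter-universal Teichmüller theory I*, kurims manuscript (May 2020), §2, proof of
Proposition 2.4 (i), p. 50 l. 27 ("`Δ̂_X` is *strongly torsion-free*") [cite: Mochizuki2012, Prop 2.4(i) p.50];
Theorem 2.6 p. 56 ("the profinite completion of … a free discrete group of finite rank")
[cite: Mochizuki2012, Thm 2.6 p.56] (D-0012 claim key, status disputed — the content of this file is plain
profinite group theory plus bookkeeping and takes no side).

PROOF-ONLY sequel (abc-iut cell, seat abc-iut-L5-t11 gen 14, row «SEC2-HTF-FROM-FREEPRO», file 2) of
`StableCurveTemperedDataOfSpecialFibreSec2HTFOfFreePro.lean` (p496636) and of abc-iut-w4-d058's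
`StableCurveTemperedDataOfSpecialFibreCor25XRoute.lean` (p496462).  Those two files re-key the §2 one-call's
law `hTF` to the ORIGIN fact about `Δ̂_X` in two Lean shapes:
* (x)  `hι : IsProSigmaCompletion {q | q.Prime} ι`, `ι : Γ →* Δ̂_X`, `Γ` free (abc-iut-L3's [SemiAnbd] Ex. 2.10
  interface; the binder displayed by the Cor. 2.3 (iii)/(iv) closers of record, GAP-LEDGER G-w4d052-g6-2);
* (x′) `e : Δ̂_X ≃ₜ* F̂` with `F̂ = profiniteCompletion F` Mathlib's profinite completion and `IsFreeOrSurface F`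
  (print's Thm 2.6 shape; abc-iut-w4-d058).
This file proves they are the SAME binder class for a free group `F` (so one census entry covers both):

* § A (generic, namespace `FreeProSigmaStrongTorsionFree`):
  `isProSigmaCompletion_primes_of_continuousMulEquiv` — (x′) ⇒ (x): for ANY group `F` and any
  topological-group isomorphism `e : P ≃ₜ* F̂`, the map `e⁻¹ ∘ η_F : F → P` is a pro-`𝔓𝔯𝔦𝔪𝔢𝔰` completion
  (abc-iut-w5-d116's model theorem `isProSigmaCompletion_toCompletion` transported by abc-iut-L3's
  `comp_continuousMulEquiv`); `exists_continuousMulEquiv_profiniteCompletion` — (x) ⇒ (x′): a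
  pro-`𝔓𝔯𝔦𝔪𝔢𝔰` completion `ι : Γ → P` with `P` profinite is isomorphic over `Γ` to `η_Γ : Γ → Γ̂`
  (uniqueness of pro-`Σ` completions, abc-iut-L3's `exists_continuousMulEquiv`), uniquely
  (`continuousMulEquiv_unique`).
* § B (the genuine 𝔛-datum): `hTF_of_continuousMulEquiv_profiniteCompletion_of_isFreeGroup` — the one-call's
  `hTF` from (x′) for a free `F` of ANY rank (through § A and p496636; abc-iut-w4-d058's `hTF_of_isFreeOrSurface`
  needs finite rank but also covers surface groups); and the JOINT NON-VACUITY of the (x)-form binder set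
  `exists_piData_cusp_isProSigmaCompletion_ab_adm`: at abc-iut-f-193's cusped `F̂₂` witness (packaged by
  abc-iut-w4-d058 as `exists_piData_cusp_isFreeOrSurface_ab_adm`) the data `PiData`, `FiniteLevels`, a cusp, the
  origin binder (x) with `Γ := F₂`, and the laws `hab` (every `Σ`) and `hadm` are SIMULTANEOUSLY inhabited.

HONEST TAGS.  A model inhabits OUR binders only (degenerate witness: admissible kernels `= 1`, compact
`Π^temp`); inhabited ≠ discharged; (x)/(x′) remain displayed ORIGIN hypotheses at genuine data (affine `X`),
consumed BY NAME.  CONDITIONAL as labelled; nothing here asserts that abc is proved or refuted, and nothing here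
bears on [IUTchIII] Cor. 3.12.
-/

noncomputable section

namespace Literature.IUT.HodgeTheaters

open _root_.Topology
open Literature.AnabelianGeometry.SemiGraphs Literature.AnabelianGeometry.SemiGraphs.ProfiniteSemiGraph
open Literature.AnabelianGeometry.SemiGraphs.SemiGraphOfAnabelioids (IsProSigmaCompletion)

/-! ### A. Generic: (x) ⇔ (x′) -/

namespace FreeProSigmaStrongTorsionFree

universe u v

/-- **(x′) ⇒ (x).**  If `e : P ≃ₜ* F̂` identifies the topological group `P` with Mathlib's profinite completion
of a group `F`, then `e⁻¹ ∘ η_F : F → P` exhibits `P` as a pro-`Σ` completion of `F` for `Σ =` all primes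
(abc-iut-L3's [SemiAnbd] Ex. 2.10 interface). [cite: Mochizuki2012, Thm 2.6 p.56] -/
theorem isProSigmaCompletion_primes_of_continuousMulEquiv {F : Type u} [Group F] {P : Type v} [Group P]
    [TopologicalSpace P] (e : P ≃ₜ* profiniteCompletion F) :
    IsProSigmaCompletion {q : ℕ | q.Prime} ((e.symm.toMulEquiv.toMonoidHom).comp (toCompletion F)) :=
  (IsProSigmaCompletion.isProSigmaCompletion_toCompletion F).comp_continuousMulEquiv e.symm

variable {Γ : Type u} [Group Γ] {P : Type v} [Group P] [TopologicalSpace P] [IsTopologicalGroup P]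
  [CompactSpace P] [TotallyDisconnectedSpace P] {ι : Γ →* P}

/-- **(x) ⇒ (x′).**  A pro-`𝔓𝔯𝔦𝔪𝔢𝔰` completion `ι : Γ → P` with `P` profinite is Mathlib's profinite
completion: there is an isomorphism of topological groups `e : P ≃ₜ* Γ̂` with `e ∘ ι = η_Γ` (uniqueness of
pro-`Σ` completions, abc-iut-L3). [cite: Mochizuki2012, Thm 2.6 p.56] -/
theorem exists_continuousMulEquiv_profiniteCompletion (hι : IsProSigmaCompletion {q : ℕ | q.Prime} ι) :
    ∃ e : P ≃ₜ* profiniteCompletion Γ, ∀ γ, e (ι γ) = toCompletion Γ γ :=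
  hι.exists_continuousMulEquiv (IsProSigmaCompletion.isProSigmaCompletion_toCompletion Γ)

omit [IsTopologicalGroup P] [CompactSpace P] [TotallyDisconnectedSpace P] in
/-- … and such an `e` is unique. [cite: Mochizuki2012, Thm 2.6 p.56] -/
theorem continuousMulEquiv_profiniteCompletion_unique (hι : IsProSigmaCompletion {q : ℕ | q.Prime} ι)
    {e e' : P ≃ₜ* profiniteCompletion Γ} (he : ∀ γ, e (ι γ) = toCompletion Γ γ)
    (he' : ∀ γ, e' (ι γ) = toCompletion Γ γ) : e = e' :=
  hι.continuousMulEquiv_unique he he'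

end FreeProSigmaStrongTorsionFree

/-! ### B. The genuine 𝔛-datum -/

namespace StableCurveTemperedData

namespace OfSpecialFibre

/-- **The §2 law `hTF` from the (x′)-shape origin fact for a FREE group of ANY rank**: if
`e : Δ̂_X ≃ₜ* F̂` with `F` free (no finite-rank clause), then `Δ̂_X` is strongly torsion-free in the printed
character form — (x′) ⇒ (x) (§ A) followed by p496636's `hTF_of_isProSigmaCompletion`.  (abc-iut-w4-d058's
`hTF_of_isFreeOrSurface` covers free-of-finite-rank OR surface `F`.) [cite: Mochizuki2012, Prop 2.4(i) p.50]
[claim: Mochizuki2012, status: disputed] -/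
theorem hTF_of_continuousMulEquiv_profiniteCompletion_of_isFreeGroup {p : ℕ} [Fact p.Prime]
    (X : TemperedCurve p) {F : Type} [Group F] [IsFreeGroup F] (e : X.DeltaHat ≃ₜ* profiniteCompletion F) :
    ∀ H : Subgroup X.DeltaHat, IsOpen (H : Set X.DeltaHat) →
      ∀ (h : H) (n : ℕ), n ≠ 0 →
        SigmaCharDetects Set.univ H h → SigmaCharDetects Set.univ H (h ^ n) :=
  hTF_of_isProSigmaCompletion X
    (FreeProSigmaStrongTorsionFree.isProSigmaCompletion_primes_of_continuousMulEquiv e)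

/-- **Joint non-vacuity of the (x)-form binder set of the §2 one-call** (binders of p496636's
`prop24_cor25_ofPiData_byName_noRF_frame_of_freePro` that are not per-level DATA): at abc-iut-f-193's cusped
`F̂₂` witness (abc-iut-w4-d058's packaging `exists_piData_cusp_isFreeOrSurface_ab_adm`) there are SIMULTANEOUSLY
a `PiData`, finite levels, a cusp, the ORIGIN binder (x) `IsProSigmaCompletion {q | q.Prime} ι` with
`ι : F₂ →* Δ̂_X` (`F₂` free on two generators), the pro-`Σ` abelianization law `hab` for EVERY `Σ`, and
`hadm` — the last three because the witness has `admKer_i = 1` and `Δ̂_X ≃ₜ* F̂₂`.  A model inhabits OUR binders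
only; inhabited ≠ discharged. [cite: Mochizuki2012, Prop 2.4 pp.50-51] [claim: Mochizuki2012, status: disputed] -/
theorem exists_piData_cusp_isProSigmaCompletion_ab_adm (p : ℕ) [Fact p.Prime] :
    ∃ (X : TemperedCurve p) (d : X.GroupLevelData) (S : SpecialFibreData (X.toTemperedArithmeticGroup d))
      (T : SpecialFibreTower X.DeltaTemp),
      Nonempty (SpecialFibreTower.PiData X d S T) ∧ SpecialFibreTower.FiniteLevels X d S T ∧ X.K = ⊥ ∧
        Nonempty {x : X.Pt // X.IsCusp x} ∧ (∀ i, T.admKer i = ⊥) ∧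
        (∃ ι : FreeGroup (Fin 2) →* X.DeltaHat, IsProSigmaCompletion {q : ℕ | q.Prime} ι) ∧
        (∀ (Sigma : Set ℕ) (i : ℕ) (A : Type) [CommGroup A] [Finite A] (χ : T.N i →* A),
            IsOpen ((χ.ker : Subgroup (T.N i)) : Set (T.N i)) →
            (∀ q : ℕ, q.Prime → q ∣ Nat.card A → q ∈ Sigma) → (T.adm i).toMonoidHom.ker ≤ χ.ker) ∧
        (∀ U ∈ 𝓝 (1 : ↥X.DeltaTemp), ∃ j, ((T.admKer j : Subgroup ↥X.DeltaTemp) : Set ↥X.DeltaTemp) ⊆ U) := by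
  obtain ⟨X, d, S, T, hP, hF, hK, hx, hadm0, ⟨-, ⟨e⟩⟩, hab, hadm⟩ :=
    exists_piData_cusp_isFreeOrSurface_ab_adm p
  exact ⟨X, d, S, T, hP, hF, hK, hx, hadm0,
    ⟨_, FreeProSigmaStrongTorsionFree.isProSigmaCompletion_primes_of_continuousMulEquiv e⟩, hab, hadm⟩

end OfSpecialFibre

end StableCurveTemperedData

end Literature.IUT.HodgeTheaters

end
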